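import Mathlib
import HarnessLib
import HarnessLib.Audit
import Summits.CriticalPhenomena.Statement

/-!
Route: PercNearOneGluing

CLOSED (closed) 2026-08-20T12:43:33Z by operator:999:1213088 — reason: closed by p205010 (crux stmt-CriticalPhenomena-4575 proved, PercNearOneGluingNoHeavyLowerTailCSHTheoremOne) / p205530 (crux 4576); every wanted item closed/proved; coordinator decision 2026-08-20 — note: closed by p205010 (crux stmt-CriticalPhenomena-4575 proved, PercNearOneGluingNoHeavyLowerTailCSHTheoremOne) / p205530 (crux 4576); every wanted item closed/proved; coordinator decision 2026-08-20. The file is kept as the record of this route; refuted decls are indexed as negative knowledge (`ledger negatives`).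

# Route PercNearOneGluing — Kozma–Nitzan near-one gluing (Conjecture 3) on finite weighted graphs,
with a slab-form bridge that assembles today and two engines (no heavy lower tail; additive gluing)

It suffices to show X = NearOneGluing, Kozma–Nitzan's Conjecture 3 (arXiv:2401.12397, p.15), typed
over ALL finite
weighted graphs: for every ε > 0 there is δ > 0 such that for every n, every edge-weight function w
on the pairs of
Fin n (percolation measure = the inhomogeneous product Bernoulli measure prodBernoulli w on bond
configurations), every
relay set A, and vertices o, b: if P(o ↔ A) > 1 − δ and P(a ↔ b) > 1 − δ for every a ∈ A, then P(o ↔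
b) > 1 − ε —
UNIFORMLY in |A| (for bounded |A| it is the union bound). Card realised: kn-near-one-gluing (spine).
X reaches the
conjunct through the bridge KNSlabBridge (KN Theorem 6 for d = 3, stated as what its proof delivers:
X ∧ θ(p) > 0 ⇒
some slab percolates at the same p), and the assembly KNSlabBridge → X → PercolationContinuityZ3 is
provable NOW from
the proved cone facts Literature.Barriers.CriticalPhenomena.percolationContinuity_of_samePSlab and
Literature.Probability.Percolation.DuminilCopinSidoraviciusTassion2016_holds (checked sorry-free in
Sketch.lean).
Lean: `∀ ε : ℝ, 0 < ε → ∃ δ : ℝ, 0 < δ ∧ ∀ (n : ℕ) (w : Sym2 (Fin n) → unitInterval) (A : Finset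
(Fin n)) (o b : Fin n), 1 - δ < (Literature.Probability.LatticeModels.prodBernoulli w).real (⋃ a ∈
A, Literature.Probability.Percolation.openConn o a) → (∀ a ∈ A, 1 - δ <
(Literature.Probability.LatticeModels.prodBernoulli w).real
(Literature.Probability.Percolation.openConn a b)) → 1 - ε <
(Literature.Probability.LatticeModels.prodBernoulli w).real
(Literature.Probability.Percolation.openConn o b)`

## Assembly
Pure logic plus two PROVED cone facts, sorry-free in Sketch.lean with axioms {propext,
Classical.choice, Quot.sound}:
`fun hB hX => Literature.Barriers.CriticalPhenomena.percolationContinuity_of_samePSlab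
Literature.Probability.Percolation.DuminilCopinSidoraviciusTassion2016_holds (hB hX)` — if θ(p_c) >
0, the bridge gives a slab S_k percolating at p_c(Z³), contradicting θ_{S_k}(p_c(Z³)) = 0
(Duminil-Copin–Sidoravicius–Tassion 2016, formalised: either p_c(Z³) < p_c(S_k) or they coincide and
DST applies). The engines feed X one level down: NoHeavyLowerTail → X (NoHeavyLowerTailSuffices) and
AdditiveGluing → X (AdditiveGluingSuffices); neither is a hypothesis of the assembly, so refuting an
engine does not break the line.

Rationale: WHY THIS LINE. KozmaNitzan2024 (arXiv:2401.12397, §1 approach (1), §4) make explicit the 'inequality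
that needs to be justified' in the
one-step same-p renormalisation of Barsky–Grimmett–Newman / Grimmett–Marstrand and prove (Thm 6)
that the |A|-uniform
near-one gluing principle (their Conjecture 3, a finite-graph statement) implies θ(p_c) = 0 on Z^d
for every d ≥ 2; no
existing route of this sub-problem files Conjecture 3 or any graph-general inequality as an item
(PercOpenSupercrit,
PercHalfSpace, PercFiniteBoxLRO cite KN only as context). What is imported: finite-graph
correlation-inequality
technology (Harris/FKG, vdBerg–Kahn / vdBerg–Häggström–Kahn conditional inequalities used by KN, the
decision-tree
inequalities of Gladkov–Zimin arXiv:2408.08457 / arXiv:2404.08873 — the only proved ε–δ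
general-graph statement of this
genre, Gladkov Thm 1.3, is for three points), local-modification/entropy bookkeeping
(AizenmanKestenNewmanCMP1987), and
certified exact computation as refute-first insurance. Two things are new relative to the card and
to KN: (a) a proved
reduction (Harris + Markov: E[N; o ↮ b] ≤ δ·E N for N = |C(o) ∩ A|) showing Conjecture 3 can only
fail through a heavy
LOWER tail of N, filed as the engine crux NoHeavyLowerTail with its glue; (b) the finitely-refutable
linear proxy
AdditiveGluing (the union-bound form of KN's Conjecture 1, strictly between Conj 1 and Conj 3),
which is where certified
search bites (an ε–δ statement cannot be refuted by one finite computation). The bridge is filed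
FIRST (rank 2) as the
instruction for unproved named facts demands, in slab form so that the final step rests on the
PROVED DST slab theorem
rather than on Aizenman–Grimmett strict inequalities.

RANKED CRUXES. #2 KNSlabBridge (crux) — Kozma–Nitzan Theorem 6 for d = 3 in the form its proof
delivers (arXiv:2401.12397 §4, pp.15–31: Lemmas 6–12 and the block exploration process, 'at p there
is percolation in some slab'): if NearOneGluing holds then for every p with θ_{Z³}(p) > 0 there is k
> 0 such that the slab S_k = {0 ≤ x₀ ≤ k} (slabGraph 3 k, rooted at slabOrigin) percolates at the
SAME p. Inputs of the printed proof: Lemma 7 (local two-cluster uniqueness; follows from a.s.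
uniqueness AizenmanKestenNewmanCMP1987 / BurtonKeane1989 by continuity, KN p.15), FKG square-root
trick (Lemma 9), lattice symmetries, contraction graphs K_ξ (= weight-1 edges, hence the WEIGHTED
form of X), a supercritical dependent 2-D site exploration lemma (p.25, 'well-known', cf.
GrimmettMarstrand1990 Lemma 1), p_c^site(Z²) < 1. Filed first because it is the unproved published
fact the mechanism needs. [difficulty: XL] (why it might fail: A published theorem, so the risk is a
gap, not falsity: Step II's counting, the conditioning on ω|D in (30) and the 'well-known'
exploration lemma (p.25) are sketched; KN's slabs Z²×[−5r,5r] must be matched to slab 3 k by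
symmetry; XL formalisation.) [KozmaNitzan2024, AizenmanKestenNewmanCMP1987, BurtonKeane1989,
GrimmettMarstrand1990, Grimmett1999, DuminilCopinSidoraviciusTassion2016]
#3 NearOneGluing (crux) — X itself — Kozma–Nitzan Conjecture 3 (arXiv:2401.12397 p.15) over finite
weighted graphs (vertices Fin n, weights w : Sym2 (Fin n) → [0,1], measure prodBernoulli w, events
openConn): ∀ ε > 0 ∃ δ > 0 such that P(o ↔ A) > 1 − δ and (∀ a ∈ A, P(a ↔ b) > 1 − δ) imply P(o ↔ b)
> 1 − ε. The whole content is uniformity in |A| (for |A| ≤ k the union bound gives P(o ↮ b) <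
(k+1)δ). Equivalent to the uniform-weight-1/2 version (support HalfWeightReduction) and implied by
each engine crux below. [difficulty: open-problem] (why it might fail: KN 'were not able to prove or
disprove' even Conj 1 beyond |A|=2 / special |A|=3 and offer only 'admittedly restricted' numerics;
FKG-feeling general-graph inequalities do fail by gadgets (bunkbed, arXiv:2410.02545); a family with
bimodal N = |C(o) ∩ A| would kill it.) [KozmaNitzan2024, GladkovPakZimin2024, Gladkov2024,
GladkovZimin2024]
#4 NoHeavyLowerTail (crux) — ENGINE (sufficient for X by support NoHeavyLowerTailSuffices): for
every ε > 0 there is δ > 0 such that on every finite weighted graph, if P(o ↔ A) > 1 − δ and P(a ↔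
a′) > 1 − δ for all a, a′ ∈ A, then P(1 ≤ N < (δ/ε)·E N) < ε, where N = |C(o) ∩ A| and E N = Σ_{a∈A}
P(o ↔ a). Reason it is the right residual statement: for fixed b, {o ↔ a} is increasing and {a ↮ b}
decreasing, so Harris gives E[N; o ↮ b] = Σ_a P(o ↔ a, a ↮ b) ≤ δ·E N; hence P(o ↮ b) ≤ P(N = 0) +
P(1 ≤ N < t) + δ E N / t for every t > 0, and X can fail only through configurations where o meets A
but in far fewer points than average ('pocket with few fingers'). No b appears: the law of N given a
(1−δ)-reliable relay set is the object. Conjecturally the bound is even LINEAR and λ-uniform — P(1 ≤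
N < E N/2) ≤ C·(P(o ↮ A) + max_{a,a′} P(a ↮ a′)) — which is finitely refutable; stars, brooms,
chains and trees of near-cliques give C ≤ 1 (planner's check); refuters should test that form first.
[difficulty: L] (why it might fail: Strictly stronger than X: a dependent relay structure
(chains/trees of near-cliques, shared bottlenecks) might make 'o meets A but only a (δ/ε)-fraction
of its mean share' have probability ≥ ε while P(o ↔ b) stays large; stars, brooms, chains and binary
trees of cliques all pass with room.) [KozmaNitzan2024, Harris1960, Gladkov2024,
AizenmanKestenNewmanCMP1987]
#5 AdditiveGluing (crux) — ENGINE / finitely-refutable proxy (sufficient for X by support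
AdditiveGluingSuffices, δ = ε/2): on every finite weighted graph, P(o ↔ b) ≥ P(o ↔ A) − max_{a∈A}
P(a ↮ b), written with a slack parameter t ≥ max_a P(a ↮ b). It treats the relay set A as a single
vertex (for |A| = 1 it IS the union bound {o ↮ b} ⊆ {o ↮ a} ∪ {a ↮ b}); it follows from KN's
Conjecture 1 because (1−x)(1−y) ≥ 1 − x − y, and it is the statement an exact small-graph search can
refute with one witness (an ε–δ statement cannot be). [difficulty: open-problem] (why it might fail:
In the near-one regime it is as strong as KN Conj 1 (open already for general |A| = 3, KN Thm 2–3
cover special cases); one explicit weighted graph refutes it, and bunkbed-type gadgets (Hollom;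
Gladkov–Pak–Zimin arXiv:2410.02545) are exactly the threat.) [KozmaNitzan2024, GladkovPakZimin2024,
GladkovZimin2024, Gladkov2024]
#9 NoHeavyLowerTailSuffices (support) — glue, provable now: NoHeavyLowerTail → NearOneGluing. Proof:
given ε take δ₀ from NoHeavyLowerTail at ε/3 and δ = min(δ₀/2, ε/3); pairwise reliability of A
follows from P(a ↔ a′) ≥ P(a ↔ b)·P(b ↔ a′) > 1 − 2δ (Harris,
Literature.Probability.Percolation.infinitePi_harris transported to prodBernoulli); then P(o ↮ b) ≤
P(N = 0) + P(1 ≤ N < t) + E[N; o ↮ b]/t with t = 3δ₀·E N/ε and E[N; o ↮ b] ≤ δ·E N (Harris,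
increasing × decreasing) gives P(o ↮ b) < ε/3 + ε/3 + ε/6. [difficulty: provable-now] [Harris1960,
KozmaNitzan2024]
#9 AdditiveGluingSuffices (support) — glue, provable now (4 lines, checked in Sketch.lean):
AdditiveGluing → NearOneGluing with δ = ε/2 (apply AdditiveGluing with t = ε/2). [difficulty:
provable-now] [KozmaNitzan2024]
#9 HalfWeightReduction (support) — normal-form reduction (KozmaNitzan2024 §5.6(1), adapted to the
asymptotic statement): Conjecture 3 for UNIFORM weight 1/2 on simple graphs (bondPercolation G half,
G : SimpleGraph (Fin n)) implies NearOneGluing for arbitrary weights. Proof: replace each weighted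
pair by a disjoint series–parallel gadget of 1/2-edges whose two-terminal reliability approximates
the weight (reliabilities of such gadgets are dense in [0,1]); gadget replacement preserves
connection probabilities among original vertices exactly; connection probabilities are polynomial
(continuous) in the weights, and the hypotheses are open conditions, so apply the 1/2-version at ε/2
and pass to the limit. Turns X into a counting statement (useful for certified search and for
local-modification arguments). Caution recorded: combining weights 1/2 with degree ≤ 3 is NOT
available (KN §5.6: 'would require a new idea') and would make near-one hypotheses vacuous (P(v
isolated) ≥ 1/8). [difficulty: M] [KozmaNitzan2024, Grimmett1999]

TWO-LAYER PLAN. Foreseen glued splits (nothing filed now; k ≤ 3, depth 1). KNSlabBridge ⇐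
KNTargetLemma (X ⇒ KN Lemma 10: reach B w.h.p. ⇒ reach any target T w.h.p., on graphs with subboxes)
→ KNSteering (Lemmas 11–12: elongated boxes and the corridor geometry are hittable) →
KNSlabExploration (the block exploration dominates supercritical 2-D site percolation, hence S_{10r}
percolates at p) → KNSlabBridge. NearOneGluing ⇐ (already) NoHeavyLowerTail, or ⇐ BoundedFingers
(P(1 ≤ N ≤ m, o ↮ b) ≤ C_m·(P(o ↮ A) + max_a P(a ↮ b))^{κ_m} in the weight-1/2 normal form, by
AKN-type local modification: close the fingers, count re-attachments) → LargeMeanTail (the regime E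
N ≥ K/δ of NoHeavyLowerTail) → NearOneGluing. AdditiveGluing ⇐ LevelSetCase (A = {a : P(a ↔ b) ≥ 1 −
t}, WLOG by KN §5.6(4)) → an induction on |E| guarded by KN Thm 13 (the naive edge-addition
induction is impossible) → AdditiveGluing.

KILL CRITERIA. A certified counterexample FAMILY to NearOneGluing (e.g. a gadget sequence with
bimodal N and P(o ↔ b) ≤ 1 − ε under δ → 0) closes the route `refuted:NearOneGluing` and is filed as
negative knowledge against the KN programme in every dimension. A single-graph refutation of
AdditiveGluing (hence of KN Conj 1) or a refutation of NoHeavyLowerTail does NOT kill the line: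
`route edit --drop <Decl>` (neither is a hypothesis of the assembly), record the witness on
NearOneGluing as the template to iterate, and re-rank. KNSlabBridge is a published theorem: a
located gap ⇒ `--restate` with the extra hypothesis KN actually use (never drop).
PercolationContinuityZ3 proved by another route moots the assembly but not X (X gives all 3 ≤ d ≤ 10
at once, KN Thm 6).

NOT DECOMPOSED YET. The 16-page proof of KNSlabBridge (target lemma, steering lemmas, exploration;
the identification of KN's slab Z²×[−5r,5r] with slab 3 (10r) by a lattice symmetry; local
uniqueness Lemma 7 from AKN/Burton–Keane; p_c^site(Z²) < 1) — layer-2 children once a prover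
engages. The Harris inequality for prodBernoulli on Set (Sym2 (Fin n)) (transport of
Literature.Probability.Percolation.infinitePi_harris along MeasurableEquiv.setOf) rides as a
`--supports` lemma. Constants/rates δ(ε) in X (KN need none). The certified-search programme
(exhaustive AdditiveGluing / KN-ratio check on ≤ 8–9 vertices, then gadget blow-ups; the treewidth ≤
3 exact DP of card kn-treewidth-laboratory) is refuter/kit work attached as evidence to
AdditiveGluing and NearOneGluing, not an item. No ¬X item is filed: refuters close NearOneGluing by
its negation directly.

CHEAPEST FALSIFIER. Exact rational-arithmetic sweep of AdditiveGluing (and KN's ratio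
P(o↔b)/[P(o↔A)·min_a P(a↔b)]) over all connected simple graphs on 8–9 vertices, weights in {1/2} and
{1/4,1/2,3/4}, all (o, b, A) — ~10^7 instances, hours of kit time; one violation refutes crux 5 (and
KN Conj 1) and hands refuters the gadget to iterate against X. Toy version RUN HERE (planner, local
Python, scripts bf_fast.py / local_search.py in the planner folder): all 26704 connected labelled
graphs on 6 vertices at uniform weight 0.2, 0.5, 0.9 and 6400 random graphs on 6–7 vertices with
weights in {0.05,…,0.999}: zero violations of AdditiveGluing and of Conj 1; tightest non-trivial
family has additive slack ≈ (1−w)^6 (6 vertices, 12 edges, A = the two neighbours of b) —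
asymptotically sharp but true, so the informative sweep starts at 8–9 vertices. Lookup falsifier for
the engines' novelty: van den Berg–Engelenburg's unpublished study (KN footnote p.3); nothing in
Gladkov2024 (pp.1–2, 13, 18–19 read).

NUMBERS. KN's parameter cascade in Lemma 10: ε_conj3 = ε/2, δ = ε·δ_conj3/12, W = {ξ : φ_ξ > 1 −
12δ/ε} (pp.17, 21); directed counterexample to the Conj-1 shape: P(0→b) = 7/16 < (3/4)(5/8) = 15/32
(KN §5.7, Fig. 4); KN Thm 12: a violation of Conj 1 is at most (Σ_{e∈E} p_e/(1−p_e))^{−1/2} when all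
one-edge contractions satisfy it. Gladkov arXiv:2408.08457 Thm 1.1: P(abc)² ≤ 8 P(ab)P(ac)P(bc) on
every graph; Thm 1.3: the 3-point ε–δ dichotomy (formerly GZ24 Conj 6.2). p_c(Z³, bond) ≈ 0.2488
(numerics; only 0 < p_c < 1 is used). Planner's toy sweep (this session): n ≤ 6 exhaustive at w ∈
{0.2, 0.5, 0.9} and 6400 random weighted graphs on 6–7 vertices — no violation of AdditiveGluing /
Conj 1; max observed ratio P(o↮b)/(P(o↮A)+max_a P(a↮b)) = 1.000 (attained only in degenerate gluing
o ≡ a). Items at open: 8 (4 cruxes, 3 support, 1 assembly).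

DEFINITION REQUESTS. None. Weighted finite-graph percolation is expressed with existing
declarations: Literature.Probability.LatticeModels.prodBernoulli (IsoradialPercolation.lean, in the
cone of the summit statement), Literature.Probability.Percolation.openConn / BondConfig /
bondPercolation / half / theta / slabGraph / slabOrigin (the last two need the route import
Literature.Probability.Percolation.HalfSpace, declared in the front matter). A Harris inequality
specialised to prodBernoulli is a prover-side `--supports` lemma, not a definition.

Novelty: Searches (2026-08-15): full-text read of arXiv:2401.12397 pp.1–4, 15–27, 32–37 (Conj 3 and Thm 6
p.15; Lemmas 7–12; §5.1 Conj 4; §5.4 Thm 12; §5.6 reductions; §5.7 Thm 13); arXiv:2408.08457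
(Gladkov, Percolation inequalities and decision trees) pp.1–2, 13, 18–19 read — cites KN24 as open,
proves the 3-point ε–δ dichotomy Thm 1.3, states Conj 10.1, no |A|-uniform statement; `lit citing
arxiv:2401.12397` → 0 descendants; `lit frontier CriticalPhenomena --since 2024` (30 rows) → no KN
follow-up; `lit galaxy search "Kozma Nitzan conjectured inequality" --star all` → 0, `"post-FKG
conjecture" --star all` → 0, pdf-star paraphrase search → 0; `lit search` local daemon reset /
arXiv, S2, OpenAlex HTTP 429 this session (the card's refuter audit of 2026-08-15 ran
zbMATH/S2/galaxy with the same null result); crossref 'percolation inequalities decision trees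
Gladkov' → doi:10.1214/26-ecp760 (Gladkov–Zimin, bond does not simulate site),
doi:10.1103/physreve.109.l022101 (Gladkov–Pak). Route files of the sub-problem grep'd: KN cited
thrice as context, never as an item.
Nearest prior art found: KozmaNitzan2024 (arXiv:2401.12397) — the conjecture (Conj 3) and the bridge
(Thm 6) themselves; arXiv:2408.08457 Thm 1.3 — nearest proved ε–δ general-graph connectivity
dichotomy (three points, decision trees); in-house card kn-near-one-gluing (thinning reduction,
finger surgery, certified search).
Delta: the route turns KN's bridge into an assembly that closes today on formalised facts (slab form
+ D  [refs: 10.1214/26-ecp760, 10.1103/physreve.109.l022101, 2401.12397, 2408.08457, arxiv:2401.12397, doi:10.1214/26-ecp760, doi:10.1103/physreve.109.l022101, KozmaNitzan2024]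

Barriers (technique_class: finite-graph-gluing-inequality, same-p-renormalisation): - technique_class: finite-graph-gluing-inequality, same-p-renormalisation
- Literature.Barriers.CriticalPhenomena.SprinklingRenormalisation: not evaded but DISCHARGED
conditionally on X — KN Thm 6 is precisely a same-p (η = 0) one-step renormalisation whose missing
inequality is Conjecture 3 (KN §1 approach (1)); the route's assembly literally instantiates the
barrier file's own 'what η = 0 would give' lemma percolationContinuity_of_samePSlab, so the barrier
is met head-on at the one place the literature says it can be (the bet is X).
- Literature.Barriers.CriticalPhenomena.TransverseCrossingsNeedNotMeet: evaded in form — connections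
are glued at shared VERTICES a ∈ A (o ↔ a and a ↔ b meet at a by definition) and, in KN's Lemma 10,
at seeds/plaquettes whose edges into the target region are open; no step infers that two transverse
crossings of a box intersect.
- Literature.Barriers.CriticalPhenomena.SpanningClustersAboveSix: KN's block events carry uniqueness
(Lemma 7, two distinct crossing clusters are unlikely, from a.s. uniqueness) exactly as the barrier
demands of any finite-size criterion, and the conclusion θ(p_c) = 0 is claimed for all d ≥ 2
including d > 6, where it is true (Hara; Fitzner–van der Hofstad) — no tension with Aizenman 1997.
- Literature.Barriers.CriticalPhenomena.RandomClusterFirstOrder: the line is not q-uniform, and the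
q = 1 input is located precisely: KN's bridge (FKG square-root trick, local uniqueness,
domain-Markov contraction of explored clusters,

History (route lifecycle, newest last):
- 2026-08-15T16:12:18Z · rev 2: restated KNSlabBridge (stmt-CriticalPhenomena-4573) — route-repair (cone, unit rbadge-CriticalPhenomena-PercNearOneGl-83cd1e04-g4): needs-fact: none. Of the unproved named facts in the import cone (BarskyGrimmettNe (planner-rbadge-CriticalPhenomena-PercNearOneGl-83cd1e04-g4-0)
- 2026-08-20T12:43:33Z · CLOSED closed — closed by p205010 (crux stmt-CriticalPhenomena-4575 proved, PercNearOneGluingNoHeavyLowerTailCSHTheoremOne) / p205530 (crux 4576); every wanted item closed/proved; coordinator decision 2026-08-20 (operator:999:1213088)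

sub-problem: PercolationContinuityZ3 · status: closed(closed) · opened planner-plancard-CriticalPhenomena-Percolatio-d3b0598a-0 2026-08-15T11:34:33Z · rev 6 · ledger route-CriticalPhenomena-PercNearOneGluing
GENERATED by the gate from the ledger (D-0016/17). Provers cite these decls: `theorem foo : Summit.CriticalPhenomena.PercolationContinuityZ3.Theses.PercNearOneGluing.<Decl> := …` in Summits/CriticalPhenomena/PercolationContinuityZ3/Theorems/<Name>.lean.
-/

namespace Summit.CriticalPhenomena.PercolationContinuityZ3.Theses.PercNearOneGluing

open scoped BigOperators Topology Manifold Classical MeasureTheory ProbabilityTheory Matrix InnerProductSpace ComplexConjugate ContinuousMap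
open Filter Set Function TopologicalSpace MeasureTheory

attribute [summit_statement] _root_.PercolationContinuityZ3

/-- item stmt-CriticalPhenomena-4574 · crux · rank 3 · closed · proved by Summit.CriticalPhenomena.PercolationContinuityZ3.Theorems.NearOneGluing_proof @ 2e6c16312cc9 (prover) · by planner
why it might fail: Open even for its authors (KN arXiv:2401.12397 p.3: Conj 1 'not able to prove or disprove'; Thms 1–2 settle only |A|=2 and a special |A|=3); plausible general-graph correlation inequalities do fail by gadgets (bunkbed, arXiv:2410.02545); a family with E N ≥ ε/δ and bimodal N=|C(o)∩A| refutes it.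
sources: KozmaNitzan2024, Literature.Probability.Percolation.KozmaNitzan2024_conjecture3, GladkovPakZimin2024, Gladkov2024, GladkovZimin2024
[crux] X itself — Kozma–Nitzan Conjecture 3 (arXiv:2401.12397 p.15) over finite weighted graphs
(vertices Fin n, weights w : Sym2 (Fin n) → [0,1], measure prodBernoulli w, events openConn): ∀ ε >
0 ∃ δ > 0 such that P(o ↔ A) > 1 − δ and (∀ a ∈ A, P(a ↔ b) > 1 − δ) imply P(o ↔ b) > 1 − ε. The
whole content is uniformity in |A| (for |A| ≤ k the union bound gives P(o ↮ b) < (k+1)δ). Equivalent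
to the uniform-weight-1/2 version (support HalfWeightReduction) and implied by each engine crux
below. [difficulty: open-problem] -/
@[route_item "route-CriticalPhenomena-PercNearOneGluing"]
def NearOneGluing : Prop :=
  ∀ ε : ℝ, 0 < ε → ∃ δ : ℝ, 0 < δ ∧ ∀ (n : ℕ) (w : Sym2 (Fin n) → unitInterval) (A : Finset (Fin n)) (o b : Fin n), 1 - δ < (Literature.Probability.LatticeModels.prodBernoulli w).real (⋃ a ∈ A, Literature.Probability.Percolation.openConn o a) → (∀ a ∈ A, 1 - δ < (Literature.Probability.LatticeModels.prodBernoulli w).real (Literature.Probability.Percolation.openConn a b)) → 1 - ε < (Literature.Probability.LatticeModels.prodBernoulli w).real (Literature.Probability.Percolation.openConn o b)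

/-- item stmt-CriticalPhenomena-4575 · crux · rank 4 · closed · proved by Summit.CriticalPhenomena.PercolationContinuityZ3.Theorems.CSH.noHeavyLowerTail_holds @ 9678a579b81e (prover) · by planner
why it might fail: Strictly stronger than X, not in print: a correlated 'pocket with few fingers' (chains/trees of near-cliques sharing bottlenecks, pairwise reliability > 1−δ) could give P(1 ≤ N < (δ/ε)·E N) ≥ ε; only stars, brooms, cliques-behind-an-edge, trees of cliques checked by hand; sweep j001007 pending.
sources: KozmaNitzan2024, Harris1960, Gladkov2024, AizenmanKestenNewmanCMP1987
[crux] ENGINE (sufficient for X by support NoHeavyLowerTailSuffices): for every ε > 0 there is δ > 0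
such that on every finite weighted graph, if P(o ↔ A) > 1 − δ and P(a ↔ a′) > 1 − δ for all a, a′ ∈
A, then P(1 ≤ N < (δ/ε)·E N) < ε, where N = |C(o) ∩ A| and E N = Σ_{a∈A} P(o ↔ a). Reason it is the
right residual statement: for fixed b, {o ↔ a} is increasing and {a ↮ b} decreasing, so Harris gives
E[N; o ↮ b] = Σ_a P(o ↔ a, a ↮ b) ≤ δ·E N; hence P(o ↮ b) ≤ P(N = 0) + P(1 ≤ N < t) + δ E N / t for
every t > 0, and X can fail only through configurations where o meets A but in far fewer points than
average ('pocket with few fingers'). No b appears: the law of N given a (1−δ)-reliable relay set is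
the object. Conjecturally the bound is even LINEAR and λ-uniform — P(1 ≤ N < E N/2) ≤ C·(P(o ↮ A) +
max_{a,a′} P(a ↮ a′)) — which is finitely refutable; stars, brooms, chains and trees of near-cliques
give C ≤ 1 (planner's check); refuters should test that form first. [difficulty: L] -/
@[route_item "route-CriticalPhenomena-PercNearOneGluing"]
def NoHeavyLowerTail : Prop :=
  ∀ ε : ℝ, 0 < ε → ∃ δ : ℝ, 0 < δ ∧ ∀ (n : ℕ) (w : Sym2 (Fin n) → unitInterval) (A : Finset (Fin n)) (o : Fin n), 1 - δ < (Literature.Probability.LatticeModels.prodBernoulli w).real (⋃ a ∈ A, Literature.Probability.Percolation.openConn o a) → (∀ a ∈ A, ∀ a' ∈ A, 1 - δ < (Literature.Probability.LatticeModels.prodBernoulli w).real (Literature.Probability.Percolation.openConn a a')) → (Literature.Probability.LatticeModels.prodBernoulli w).real {ω | 1 ≤ (A.filter fun a => ω ∈ Literature.Probability.Percolation.openConn o a).card ∧ ((A.filter fun a => ω ∈ Literature.Probability.Percolation.openConn o a).card : ℝ) < δ * (∑ a ∈ A, (Literature.Probability.LatticeModels.prodBernoulli w).real (Literature.Probability.Percolation.openConn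 o a)) / ε} < ε

/-- item stmt-CriticalPhenomena-4576 · crux · rank 5 · closed · proved by Summit.CriticalPhenomena.PercolationContinuityZ3.Theorems.AdditiveGluing_proof @ 0bbadc66f985 (prover) · by planner
why it might fail: One weighted graph refutes it; near one it is as strong as KN Conj 1 (open; only |A|=2 and a special |A|=3 proved, KN Thms 1–2); the DIRECTED analogue of Conj 1 fails (KN §5.7 Fig.4: 7/16 < 15/32); bunkbed-type gadgets (arXiv:2410.02545) break such inequalities; exhaustive checks reach n ≤ 7 only.
sources: KozmaNitzan2024, GladkovPakZimin2024, GladkovZimin2024, Gladkov2024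
[crux] ENGINE / finitely-refutable proxy (sufficient for X by support AdditiveGluingSuffices, δ =
ε/2): on every finite weighted graph, P(o ↔ b) ≥ P(o ↔ A) − max_{a∈A} P(a ↮ b), written with a slack
parameter t ≥ max_a P(a ↮ b). It treats the relay set A as a single vertex (for |A| = 1 it IS the
union bound {o ↮ b} ⊆ {o ↮ a} ∪ {a ↮ b}); it follows from KN's Conjecture 1 because (1−x)(1−y) ≥ 1 −
x − y, and it is the statement an exact small-graph search can refute with one witness (an ε–δ
statement cannot be). [difficulty: open-problem] -/
@[route_item "route-CriticalPhenomena-PercNearOneGluing"]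
def AdditiveGluing : Prop :=
  ∀ (n : ℕ) (w : Sym2 (Fin n) → unitInterval) (A : Finset (Fin n)) (o b : Fin n) (t : ℝ), 0 ≤ t → (∀ a ∈ A, 1 - t ≤ (Literature.Probability.LatticeModels.prodBernoulli w).real (Literature.Probability.Percolation.openConn a b)) → (Literature.Probability.LatticeModels.prodBernoulli w).real (⋃ a ∈ A, Literature.Probability.Percolation.openConn o a) - t ≤ (Literature.Probability.LatticeModels.prodBernoulli w).real (Literature.Probability.Percolation.openConn o b)

-- earlier KNSlabBridge (stmt-CriticalPhenomena-4573, replaced 2026-08-15T16:12:18Z -> stmt-CriticalPhenomena-10357): retired by None — (∀ ε : ℝ, 0 < ε → ∃ δ : ℝ, 0 < δ ∧ ∀ (n : ℕ) (w : Sym2 (Fin n) → unitInterval) (A : Finset (Fin n)) (o b : Fin n), 1 - δ < (Literature.Probability.LatticeModels.prodBernoulli w).real (⋃ a ∈ A, Literature.Probability.Percolation.openConn o a) → (∀ a ∈ A, 1 - δ < (Lite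
/-- item stmt-CriticalPhenomena-10357 · support · rank 2 · closed · proved by Summit.CriticalPhenomena.PercolationContinuityZ3.Theorems.KNSlabBridge_proof (prover) · by planner
why it might fail: Not falsity (¬item ↔ KN Conj 3 ∧ θ_{Z³}(p_c)>0, refuter-proved) but the debt of the fact it now reduces to: formalising KN §4 — p.25 exploration lemma 'we skip the details', Step II counting, conditioning on ω|D in (30), Conj 3 used on contraction graphs K_ξ with T identified to a point (pp.21–22).
sources: KozmaNitzan2024, Literature.Probability.Percolation.KozmaNitzan2024_thm6, Literature.Barriers.CriticalPhenomena.percolationContinuity_iff_samePSlab_holds, GrimmettMarstrand1990, DuminilCopinSidoraviciusTassion2016, AizenmanKestenNewmanCMP1987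
[crux] Kozma–Nitzan Theorem 6 for d = 3 in the form its proof delivers (arXiv:2401.12397 §4,
pp.15–31: Lemmas 6–12 and the block exploration process, 'at p there is percolation in some slab'):
if NearOneGluing holds then for every p with θ_{Z³}(p) > 0 there is k > 0 such that the slab S_k =
{x ∈ Z³ : 0 ≤ x₀ ≤ k}, rooted at the origin, percolates at the SAME p. The slab is written INLINE as
the induced subgraph (zdGraph 3).induce {x | 0 ≤ x 0 ∧ x 0 ≤ k} with root ⟨0, _⟩ so that the route
file imports nothing beyond the summit statement's cone; this is DEFINITIONALLY
Literature.Probability.Percolation.slabGraph 3 k rooted at slabOrigin 3 k (HalfSpace.lean: `new ↔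
old := Iff.rfl`, checked), so provers may import HalfSpace / the DST slab files freely and the
Assembly proof (percolationContinuity_of_samePSlab + DuminilCopinSidoraviciusTassion2016_holds,
candidate PercAssembly.lean on stmt-4580) is unchanged. Inputs of the printed proof: Lemma 7 (local
two-cluster uniqueness; from a.s. uniqueness AizenmanKestenNewmanCMP1987 / BurtonKeane1989 by
continuity, KN p.15), FKG square-root trick (Lemma 9), lattice symmetries (KN's slab Z²×[−5r,5r] =
S_{10r} up to a symmetry of Z³), contraction g -/
@[route_item "route-CriticalPhenomena-PercNearOneGluing"]
def KNSlabBridge : Prop :=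
  (∀ ε : ℝ, 0 < ε → ∃ δ : ℝ, 0 < δ ∧ ∀ (n : ℕ) (w : Sym2 (Fin n) → unitInterval) (A : Finset (Fin n)) (o b : Fin n), 1 - δ < (Literature.Probability.LatticeModels.prodBernoulli w).real (⋃ a ∈ A, Literature.Probability.Percolation.openConn o a) → (∀ a ∈ A, 1 - δ < (Literature.Probability.LatticeModels.prodBernoulli w).real (Literature.Probability.Percolation.openConn a b)) → 1 - ε < (Literature.Probability.LatticeModels.prodBernoulli w).real (Literature.Probability.Percolation.openConn o b)) → ∀ p : unitInterval, 0 < Literature.Probability.Percolation.theta (Literature.Probability.LatticeModels.zdGraph 3) 0 p → ∃ k : ℕ, 0 < k ∧ 0 < Literature.Probability.Percolation.theta ((Literature.Probability.LatticeModels.zdGraph 3).induce {x : Literature.Probability.LatticeModels.Site 3 | 0 ≤ x 0 ∧ x 0 ≤ (k : ℤ)}) ⟨0, ⟨le_rfl, Int.natCast_nonneg k⟩⟩ p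

/-- item stmt-CriticalPhenomena-14716 · support · rank 9 · closed · proved by Summit.CriticalPhenomena.PercolationContinuityZ3.Theorems.noHeavyLowerTailGlue_proof @ 200659a22743 (prover) · by planner
sources: Harris1960, KozmaNitzan2024
[support] glue BY NAME (route-repair unused-crux 2026-08-16): the engine crux NoHeavyLowerTail
implies X = NearOneGluing, stated over the route decls so that NoHeavyLowerTail lies in the cone of
`closes` (its hypothesis NearOneGluing is derived via this item). Definitionally equal to the PROVED
item NoHeavyLowerTailSuffices (stmt-CriticalPhenomena-4577; `example : NoHeavyLowerTailGlue =
NoHeavyLowerTailSuffices := rfl`). Provable now in one line: `theorem noHeavyLowerTailGlue_proof :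
NoHeavyLowerTailGlue := fun h =>
Summit.CriticalPhenomena.PercolationContinuityZ3.Theorems.noHeavyLowerTailSuffices_proof h` (import
Summits.CriticalPhenomena.PercolationContinuityZ3.Theorems.PercNearOneGluingNoHeavyLowerTailSuffices;
Lean-checked, axioms propext/Classical.choice/Quot.sound). Mathematical content (already landed in
4577): given ε take δ₀ from NoHeavyLowerTail at ε/3, δ = min(δ₀/2, ε/3); pairwise reliability of A
by the union bound through b; cover {o ↮ b} ⊆ {N = 0} ∪ {1 ≤ N < t} ∪ ({t ≤ N} ∩ {o ↮ b}) with N =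
|C(o) ∩ A|, t = 3δ₀·E N/ε; Harris (increasing × decreasing) + Markov bound the last term by δ·E N/t.
[deps: NoHeavyLowerTail, NearOneGluing, NoHeavyLowerTailSuffices] [difficulty: -/
@[route_item "route-CriticalPhenomena-PercNearOneGluing"]
def NoHeavyLowerTailGlue : Prop :=
  NoHeavyLowerTail → NearOneGluing

/-- item stmt-CriticalPhenomena-14717 · support · rank 9 · closed · proved by Summit.CriticalPhenomena.PercolationContinuityZ3.Theorems.additiveGluingGlue_proof (prover) · by planner
sources: KozmaNitzan2024
[support] glue BY NAME (route-repair unused-crux 2026-08-16): the finitely-refutable proxy crux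
AdditiveGluing implies X = NearOneGluing (δ = ε/2: apply AdditiveGluing with slack t = ε/2), stated
over the route decls so that AdditiveGluing lies in the cone of `closes` (its hypothesis
NearOneGluing is derived via this item). Definitionally equal to the PROVED item
AdditiveGluingSuffices (stmt-CriticalPhenomena-4578; `example : AdditiveGluingGlue =
AdditiveGluingSuffices := rfl`). Provable now in one line: `theorem additiveGluingGlue_proof :
AdditiveGluingGlue := fun h =>
Summit.CriticalPhenomena.PercolationContinuityZ3.Theorems.additiveGluingSuffices_proof h` (import
Summits.CriticalPhenomena.PercolationContinuityZ3.Theorems.PercNearOneGluingAdditiveGluingSuffices;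
Lean-checked, axioms propext/Classical.choice/Quot.sound). [deps: AdditiveGluing, NearOneGluing,
AdditiveGluingSuffices] [difficulty: provable-now] -/
@[route_item "route-CriticalPhenomena-PercNearOneGluing"]
def AdditiveGluingGlue : Prop :=
  AdditiveGluing → NearOneGluing

/-- item stmt-CriticalPhenomena-4577 · support · rank 9 · closed · proved by Summit.CriticalPhenomena.PercolationContinuityZ3.Theorems.noHeavyLowerTailSuffices_proof (prover) · by planner
sources: Harris1960, KozmaNitzan2024
[support] glue, provable now: NoHeavyLowerTail → NearOneGluing. Proof: given ε take δ₀ from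
NoHeavyLowerTail at ε/3 and δ = min(δ₀/2, ε/3); pairwise reliability of A follows from P(a ↔ a′) ≥
P(a ↔ b)·P(b ↔ a′) > 1 − 2δ (Harris, Literature.Probability.Percolation.infinitePi_harris
transported to prodBernoulli); then P(o ↮ b) ≤ P(N = 0) + P(1 ≤ N < t) + E[N; o ↮ b]/t with t =
3δ₀·E N/ε and E[N; o ↮ b] ≤ δ·E N (Harris, increasing × decreasing) gives P(o ↮ b) < ε/3 + ε/3 +
ε/6. [difficulty: provable-now] -/
@[route_item "route-CriticalPhenomena-PercNearOneGluing"]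
def NoHeavyLowerTailSuffices : Prop :=
  (∀ ε : ℝ, 0 < ε → ∃ δ : ℝ, 0 < δ ∧ ∀ (n : ℕ) (w : Sym2 (Fin n) → unitInterval) (A : Finset (Fin n)) (o : Fin n), 1 - δ < (Literature.Probability.LatticeModels.prodBernoulli w).real (⋃ a ∈ A, Literature.Probability.Percolation.openConn o a) → (∀ a ∈ A, ∀ a' ∈ A, 1 - δ < (Literature.Probability.LatticeModels.prodBernoulli w).real (Literature.Probability.Percolation.openConn a a')) → (Literature.Probability.LatticeModels.prodBernoulli w).real {ω | 1 ≤ (A.filter fun a => ω ∈ Literature.Probability.Percolation.openConn o a).card ∧ ((A.filter fun a => ω ∈ Literature.Probability.Percolation.openConn o a).card : ℝ) < δ * (∑ a ∈ A, (Literature.Probability.LatticeModels.prodBernoulli w).real (Literature.Probability.Percolation.openConn o a)) / ε} < ε) → (∀ ε : ℝ, 0 < ε → ∃ δ : ℝ, 0 < δ ∧ ∀ (n : ℕ) (w : Sym2 (Fin n) → unitInterval) (A : Finset (Fin n)) (o b : Fin n), 1 - δ < (Literature.Probability.LatticeModels.prodBernoulli w).real (⋃ a ∈ A, Literature.Probability.Percolation.openConn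 o a) → (∀ a ∈ A, 1 - δ < (Literature.Probability.LatticeModels.prodBernoulli w).real (Literature.Probability.Percolation.openConn a b)) → 1 - ε < (Literature.Probability.LatticeModels.prodBernoulli w).real (Literature.Probability.Percolation.openConn o b))

/-- item stmt-CriticalPhenomena-4578 · support · rank 9 · closed · proved by Summit.CriticalPhenomena.PercolationContinuityZ3.Theorems.additiveGluingSuffices_proof @ 463b36317c39 (prover) · by planner
sources: KozmaNitzan2024
[support] glue, provable now (4 lines, checked in Sketch.lean): AdditiveGluing → NearOneGluing with
δ = ε/2 (apply AdditiveGluing with t = ε/2). [difficulty: provable-now] -/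
@[route_item "route-CriticalPhenomena-PercNearOneGluing"]
def AdditiveGluingSuffices : Prop :=
  (∀ (n : ℕ) (w : Sym2 (Fin n) → unitInterval) (A : Finset (Fin n)) (o b : Fin n) (t : ℝ), 0 ≤ t → (∀ a ∈ A, 1 - t ≤ (Literature.Probability.LatticeModels.prodBernoulli w).real (Literature.Probability.Percolation.openConn a b)) → (Literature.Probability.LatticeModels.prodBernoulli w).real (⋃ a ∈ A, Literature.Probability.Percolation.openConn o a) - t ≤ (Literature.Probability.LatticeModels.prodBernoulli w).real (Literature.Probability.Percolation.openConn o b)) → (∀ ε : ℝ, 0 < ε → ∃ δ : ℝ, 0 < δ ∧ ∀ (n : ℕ) (w : Sym2 (Fin n) → unitInterval) (A : Finset (Fin n)) (o b : Fin n), 1 - δ < (Literature.Probability.LatticeModels.prodBernoulli w).real (⋃ a ∈ A, Literature.Probability.Percolation.openConn o a) → (∀ a ∈ A, 1 - δ < (Literature.Probability.LatticeModels.prodBernoulli w).real (Literature.Probability.Percolation.openConn a b)) → 1 - ε < (Literature.Probability.LatticeModels.prodBernoulli w).real (Literature.Probability.Percolation.openConn o b))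

/-- item stmt-CriticalPhenomena-4579 · support · rank 9 · closed · proved by Summit.CriticalPhenomena.PercolationContinuityZ3.Theorems.halfWeightReduction_proof (prover) · by planner
sources: KozmaNitzan2024, Grimmett1999
[support] normal-form reduction (KozmaNitzan2024 §5.6(1), adapted to the asymptotic statement):
Conjecture 3 for UNIFORM weight 1/2 on simple graphs (bondPercolation G half, G : SimpleGraph (Fin
n)) implies NearOneGluing for arbitrary weights. Proof: replace each weighted pair by a disjoint
series–parallel gadget of 1/2-edges whose two-terminal reliability approximates the weight
(reliabilities of such gadgets are dense in [0,1]); gadget replacement preserves connection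
probabilities among original vertices exactly; connection probabilities are polynomial (continuous)
in the weights, and the hypotheses are open conditions, so apply the 1/2-version at ε/2 and pass to
the limit. Turns X into a counting statement (useful for certified search and for local-modification
arguments). Caution recorded: combining weights 1/2 with degree ≤ 3 is NOT available (KN §5.6:
'would require a new idea') and would make near-one hypotheses vacuous (P(v isolated) ≥ 1/8).
[difficulty: M] -/
@[route_item "route-CriticalPhenomena-PercNearOneGluing"]
def HalfWeightReduction : Prop :=
  (∀ ε : ℝ, 0 < ε → ∃ δ : ℝ, 0 < δ ∧ ∀ (n : ℕ) (G : SimpleGraph (Fin n)) (A : Finset (Fin n)) (o b : Fin n), 1 - δ < (Literature.Probability.Percolation.bondPercolation G Literature.Probability.Percolation.half).real (⋃ a ∈ A, Literature.Probability.Percolation.openConn o a) → (∀ a ∈ A, 1 - δ < (Literature.Probability.Percolation.bondPercolation G Literature.Probability.Percolation.half).real (Literature.Probability.Percolation.openConn a b)) → 1 - ε < (Literature.Probability.Percolation.bondPercolation G Literature.Probability.Percolation.half).real (Literature.Probability.Percolation.openConn o b)) → (∀ ε : ℝ, 0 < ε → ∃ δ : ℝ, 0 < δ ∧ ∀ (n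 : ℕ) (w : Sym2 (Fin n) → unitInterval) (A : Finset (Fin n)) (o b : Fin n), 1 - δ < (Literature.Probability.LatticeModels.prodBernoulli w).real (⋃ a ∈ A, Literature.Probability.Percolation.openConn o a) → (∀ a ∈ A, 1 - δ < (Literature.Probability.LatticeModels.prodBernoulli w).real (Literature.Probability.Percolation.openConn a b)) → 1 - ε < (Literature.Probability.LatticeModels.prodBernoulli w).real (Literature.Probability.Percolation.openConn o b))

/-- item stmt-CriticalPhenomena-4580 · assembly · rank 1 · closed · proved by Summit.CriticalPhenomena.PercolationContinuityZ3.Theorems.percNearOneGluing_assembly_proof @ 3ffeb756c9fb (prover) · by planner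
sources: KozmaNitzan2024, DuminilCopinSidoraviciusTassion2016, Grimmett1999
[assembly] KNSlabBridge → NearOneGluing → PercolationContinuityZ3 (provable now, see above). -/
@[route_item "route-CriticalPhenomena-PercNearOneGluing"]
def Assembly : Prop :=
  KNSlabBridge → NearOneGluing → PercolationContinuityZ3

/-! D-0027 §2.1 — DECIDING THEOREM (planner-authored via `route open/edit --closes-file`; by planner-rtask-CriticalPhenomena-PercNearOneG-461c9472-0 2026-08-17T18:32:20Z) — ARCHIVED: route closed (closed) 2026-08-20T12:43:33Z; kept so importers keep building:
its hypotheses are this route's items and its conclusion the sub-problem Statement (glue_lint), and it elaborates with this file. -/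

@[closes "route-CriticalPhenomena-PercNearOneGluing"] theorem closes (h_KN : KNSlabBridge) (h_Add : AdditiveGluing) (h_Assembly : Assembly) :
    _root_.PercolationContinuityZ3 := by
  -- RGLUE either-engine (2026-08-17): ONE engine is load-bearing in this route — AdditiveGluing.
  -- X = NearOneGluing is obtained from AdditiveGluing alone with δ = ε/2; this is exactly the content of the
  -- PROVED glue item AdditiveGluingGlue (stmt-CriticalPhenomena-14717, Theorems.additiveGluingGlue_proof /
  -- additiveGluingSuffices_proof), re-derived inline because a route file cannot import its own Theorems
  -- (they import this file). Then the PROVED Assembly (stmt-4580: KNSlabBridge → NearOneGluing →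
  -- PercolationContinuityZ3) and the PROVED bridge KNSlabBridge (stmt-10357) conclude by name.
  -- The other engine, NoHeavyLowerTail, decides the conjunct through the sibling route PercNearOneGluingNoHeavy.
  refine h_Assembly h_KN ?_
  intro ε hε
  refine ⟨ε / 2, half_pos hε, ?_⟩
  intro n w A o b hoA hab
  have h := h_Add n w A o b (ε / 2) (half_pos hε).le (fun a ha => (hab a ha).le)
  linarith

end Summit.CriticalPhenomena.PercolationContinuityZ3.Theses.PercNearOneGluing
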